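import Summits.Ventures.PercRepro.Cross3
import Summits.Ventures.PercRepro.LemmaB3Kernel

/-!
# PercRepro — Lemma B at `k = 3` is a theorem (seat p3, gen 3)

`LemmaB3Abstract = LemmaBFamily cross3` (typer-2, `Cross3.lean`): for every finite `S` and every
monotone `c : Config S → Setoid (Fin 3)`, the antipodal pairs `{ω, ωᶜ}` carrying two distinct
two-block partitions are at most the antipodal pairs of type `{⊤, ⊥}`.

**Proof** (paper: `proofs/P3-lemmaB3.md`): the coordinate induction of `LemmaB3Kernel.lean` applied
to `Part(3)`, whose two-block partitions are atoms and coatoms (`cross3_isAtomCoatomFamily`, from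
the classification `Setoid.fin3_classify` of the equivalence relations on three points). The
antipodal sum of the kernel is `2·topBotCount − 2·crossCount` (`sum_bKernel_eq`), hence
`crossCount ≤ topBotCount`. Corollary: a third, independent proof of C-004
(`C004_holds_classwise`, through typer-2's `C004_of_LemmaB3Abstract`). Main theorem:
`LemmaB3Abstract_holds_classwise` (p6's `AntipodalSMC.lean` proves the same statement by the antipodal SMC
principle — the two arguments coincide, p2 04:22:24Z; this file keeps the Finset-cube induction).
-/

namespace PercRepro

open Finset

/-! ### Lemma B at `k = 3` -/

section Three

open Classical

/-- `Part(3)` is nontrivial: the discrete and the one-block partitions differ. -/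
instance instNontrivialSetoidFin3 : Nontrivial (Setoid (Fin 3)) :=
  ⟨⟨⊥, ⊤, fun h => by
    have h' : (⊥ : Setoid (Fin 3)) 0 1 := by rw [h]; trivial
    simp at h'⟩⟩

/-- Every equivalence relation on three points is `⊥`, `⊤` or one of the three two-block
partitions. -/
theorem Setoid.fin3_classify (s : Setoid (Fin 3)) : s = ⊥ ∨ s = ⊤ ∨ ∃ i, s = cross3 i := by
  by_cases h01 : s 0 1 <;> by_cases h02 : s 0 2 <;> by_cases h12 : s 1 2
  · exact Or.inr (Or.inl (Setoid.eq_top_of_rel_zero_fin3 s h01 h02))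
  · exact absurd (s.trans (s.symm h01) h02) h12
  · exact absurd (s.trans h01 h12) h02
  · refine Or.inr (Or.inr ⟨0, Setoid.ext fun a b => ?_⟩)
    have h10 : s 1 0 := s.symm h01
    have h20 : ¬ s 2 0 := fun h => h02 (s.symm h)
    have h21 : ¬ s 2 1 := fun h => h12 (s.symm h)
    rw [cross3_rel]
    fin_cases a <;> fin_cases b <;> simp [h01, h02, h12, h10, h20, h21]
  · exact absurd (s.trans h02 (s.symm h12)) h01
  · refine Or.inr (Or.inr ⟨1, Setoid.ext fun a b => ?_⟩)
    have h20 : s 2 0 := s.symm h02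
    have h10 : ¬ s 1 0 := fun h => h01 (s.symm h)
    have h21 : ¬ s 2 1 := fun h => h12 (s.symm h)
    rw [cross3_rel]
    fin_cases a <;> fin_cases b <;> simp [h01, h02, h12, h10, h20, h21]
  · refine Or.inr (Or.inr ⟨2, Setoid.ext fun a b => ?_⟩)
    have h21 : s 2 1 := s.symm h12
    have h10 : ¬ s 1 0 := fun h => h01 (s.symm h)
    have h20 : ¬ s 2 0 := fun h => h02 (s.symm h)
    rw [cross3_rel]
    fin_cases a <;> fin_cases b <;> simp [h01, h02, h12, h10, h20, h21]
  · refine Or.inl (Setoid.ext fun a b => ?_)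
    have h10 : ¬ s 1 0 := fun h => h01 (s.symm h)
    have h20 : ¬ s 2 0 := fun h => h02 (s.symm h)
    have h21 : ¬ s 2 1 := fun h => h12 (s.symm h)
    fin_cases a <;> fin_cases b <;> simp [h01, h02, h12, h10, h20, h21]

/-- The two-block partitions of three points are atoms and coatoms of `Part(3)`. -/
theorem cross3_isAtomCoatomFamily : IsAtomCoatomFamily cross3 where
  injective := cross3_injective
  ne_bot := cross3_ne_bot
  ne_top := cross3_ne_top
  atom := by
    intro i a ha
    rcases Setoid.fin3_classify a with rfl | rfl | ⟨j, rfl⟩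
    · exact Or.inl rfl
    · exact absurd (top_le_iff.mp ha) (cross3_ne_top i)
    · by_cases hij : j = i
      · exact Or.inr (hij ▸ rfl)
      · exact absurd ((inf_eq_left.mpr ha).symm.trans (cross3_inf_eq_bot hij)) (cross3_ne_bot j)
  coatom := by
    intro i a ha
    rcases Setoid.fin3_classify a with rfl | rfl | ⟨j, rfl⟩
    · exact absurd (le_bot_iff.mp ha) (cross3_ne_bot i)
    · exact Or.inr rfl
    · by_cases hij : i = j
      · exact Or.inl (hij ▸ rfl)
      · exact absurd ((sup_eq_right.mpr ha).symm.trans (cross3_sup_eq_top hij)) (cross3_ne_top j)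

variable {S : Type} [Fintype S] [DecidableEq S]

/-- The antipodal sum of the kernel is `2·topBotCount − 2·crossCount`. -/
theorem sum_bKernel_eq {k r : ℕ} (x : Fin r → Setoid (Fin k)) (hinj : Function.Injective x)
    (c : Config S → Setoid (Fin k)) :
    ∑ ω : Config S, bKernel x (c ω) (c ωᶜ) =
      2 * (topBotCount c : ℤ) - 2 * (crossCount x c : ℤ) := by
  have hg : ∑ ω : Config S, goodKer (c ω) (c ωᶜ) = 2 * (topBotCount c : ℤ) := by
    unfold goodKer topBotCount
    rw [Finset.sum_add_distrib, Finset.card_filter, Nat.cast_sum, two_mul]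
    congr 1
    · exact Finset.sum_congr rfl fun ω _ => by split_ifs <;> simp
    · refine (sum_compl_eq (fun ω ω' => if c ω = ⊥ ∧ c ω' = ⊤ then (1 : ℤ) else 0)).trans ?_
      exact Finset.sum_congr rfl fun ω _ => by
        by_cases h : c ω = ⊤ ∧ c ωᶜ = ⊥
        · rw [if_pos ⟨h.2, h.1⟩, if_pos h]; simp
        · rw [if_neg (fun h' => h ⟨h'.2, h'.1⟩), if_neg h]; simp
  have hb : ∑ ω : Config S, badKer x (c ω) (c ωᶜ) = 2 * (crossCount x c : ℤ) := by
    unfold badKer crossCount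
    rw [Finset.card_filter, Nat.cast_sum, two_mul]
    have split : ∀ ω : Config S,
        (if ∃ i j, i ≠ j ∧ c ω = x i ∧ c ωᶜ = x j then (1 : ℤ) else 0) =
          (if ∃ i j, i < j ∧ c ω = x i ∧ c ωᶜ = x j then (1 : ℤ) else 0) +
          (if ∃ i j, i < j ∧ c ωᶜ = x i ∧ c ω = x j then (1 : ℤ) else 0) := by
      intro ω
      by_cases h : ∃ i j, i ≠ j ∧ c ω = x i ∧ c ωᶜ = x j
      · obtain ⟨i, j, hij, hi, hj⟩ := h
        have e0 : (if ∃ i j, i ≠ j ∧ c ω = x i ∧ c ωᶜ = x j then (1 : ℤ) else 0) = 1 :=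
          if_pos ⟨i, j, hij, hi, hj⟩
        rcases lt_or_gt_of_ne hij with hlt | hgt
        · have e1 : (if ∃ i j, i < j ∧ c ω = x i ∧ c ωᶜ = x j then (1 : ℤ) else 0) = 1 :=
            if_pos ⟨i, j, hlt, hi, hj⟩
          have e2 : (if ∃ i j, i < j ∧ c ωᶜ = x i ∧ c ω = x j then (1 : ℤ) else 0) = 0 := by
            refine if_neg ?_
            rintro ⟨i', j', hlt', hi', hj'⟩
            have e1' : j' = i := hinj (hj'.symm.trans hi)
            have e2' : i' = j := hinj (hi'.symm.trans hj)
            subst e1'; subst e2'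
            exact lt_asymm hlt hlt'
          rw [e0, e1, e2]; rfl
        · have e1 : (if ∃ i j, i < j ∧ c ω = x i ∧ c ωᶜ = x j then (1 : ℤ) else 0) = 0 := by
            refine if_neg ?_
            rintro ⟨i', j', hlt', hi', hj'⟩
            have e1' : i' = i := hinj (hi'.symm.trans hi)
            have e2' : j' = j := hinj (hj'.symm.trans hj)
            subst e1'; subst e2'
            exact lt_asymm hlt' hgt
          have e2 : (if ∃ i j, i < j ∧ c ωᶜ = x i ∧ c ω = x j then (1 : ℤ) else 0) = 1 :=
            if_pos ⟨j, i, hgt, hj, hi⟩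
          rw [e0, e1, e2]; rfl
      · have e0 : (if ∃ i j, i ≠ j ∧ c ω = x i ∧ c ωᶜ = x j then (1 : ℤ) else 0) = 0 := if_neg h
        have e1 : (if ∃ i j, i < j ∧ c ω = x i ∧ c ωᶜ = x j then (1 : ℤ) else 0) = 0 := by
          refine if_neg ?_
          rintro ⟨i, j, hlt, hi, hj⟩; exact h ⟨i, j, hlt.ne, hi, hj⟩
        have e2 : (if ∃ i j, i < j ∧ c ωᶜ = x i ∧ c ω = x j then (1 : ℤ) else 0) = 0 := by
          refine if_neg ?_
          rintro ⟨i, j, hlt, hi, hj⟩; exact h ⟨j, i, hlt.ne', hj, hi⟩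
        rw [e0, e1, e2]; rfl
    rw [Finset.sum_congr rfl fun ω _ => split ω, Finset.sum_add_distrib]
    congr 1
    · exact Finset.sum_congr rfl fun ω _ => by split_ifs <;> simp
    · refine (sum_compl_eq (fun ω ω' => if ∃ i j, i < j ∧ c ω' = x i ∧ c ω = x j then (1 : ℤ)
        else 0)).trans ?_
      exact Finset.sum_congr rfl fun ω _ => by
        beta_reduce
        split_ifs <;> simp
  unfold bKernel
  rw [Finset.sum_sub_distrib, hg, hb]

/-- **Lemma B at `k = 3`** (typer-2's `LemmaB3Abstract`): for every finite `S` and every monotone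
`c : Config S → Part(3)`, the antipodal pairs carrying two distinct two-block partitions are at most
the antipodal pairs of type `{⊤, ⊥}`. Proof: coordinate induction with the local kernel inequality. -/
theorem LemmaB3Abstract_holds_classwise : LemmaB3Abstract := by
  intro S _ _ c hc
  have h := sum_bKernel_nonneg cross3_isAtomCoatomFamily c hc
  rw [sum_bKernel_eq cross3 cross3_injective c] at h
  omega

/-- C-004 (Gladkov's pair-sum inequality) through the classwise route: a third, independent proof. -/
theorem C004_holds_classwise : C004 := C004_of_LemmaB3Abstract LemmaB3Abstract_holds_classwise

end Three
end PercRepro
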